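import Literature.AlgebraicGeometry.AbelianSchemes.PoincareFamilyKSSurjectiveAnyChar
import Literature.AlgebraicGeometry.AbelianSchemes.PoincareFamilyPointsInjective
import Literature.AlgebraicGeometry.AbelianSchemes.PoincareFamilyGraphFormallyUnramified
import Literature.AlgebraicGeometry.AbelianSchemes.AbelianSchemeSmallExtensionPicardTorsorAnyChar
import Literature.AlgebraicGeometry.AbelianSchemes.MumfordQuotientSliceInjective
import Literature.AlgebraicGeometry.AbelianSchemes.GraphPointLevelZeroAnyChar
import Literature.AlgebraicGeometry.Deformation.MorphismLiftsSquareZeroSmoothLocal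
import Literature.AlgebraicGeometry.AbelianSchemes.AbelianSchemeDualPairNormalize
import Literature.AlgebraicGeometry.AbelianSchemes.AbelianSchemeDualIsogenyComp
import Literature.AlgebraicGeometry.Modules.PicardGroupThickeningTorsorFlat
import Literature.AlgebraicGeometry.RelativeSpec.GeometricQuotientGroupLaw
import Mathlib.AlgebraicGeometry.Noetherian
import Mathlib.RingTheory.Ideal.KrullsHeightTheorem
import Mathlib.FieldTheory.IsAlgClosed.Basic
import HarnessLib

/-!
# Mumford's dual `(A′⁄K(L′), 𝒫′)`: THE ARTINIAN TOWER of graph points in ANY characteristic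
# ([MumfordAV1970] §13, the Artinian induction in the proof of the Theorem, pp. 125–130) — the (Mc) N3′ tower OFF `ℚ`

Layer `Literature/AlgebraicGeometry/AbelianSchemes`, namespace `Literature.AlgebraicGeometry.AbelianSchemes.MumfordDual` (the sub-namespace names
Mumford's construction of the dual abelian scheme).  THEOREMS ONLY (no definition, no named fact, no instance, no notation, no `sorry`).  Cell
`hodgecm-mathlib` (D-0151), P6 «MOD programme», L4 DUALS road (pay-down of the printed row P-2′ through the re-typed socket
`stub_DUALS : DualPairOfAmpleRigidified`, LEAD F0P6-plan (g3) «M-55c»; LA4-p05 (g0)), road (A) re-thread file **O3a = N3′**: the Summits file ★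
`Theorems/F3DualAbelianSchemeMcN3Tower` (namespace `Summit.HodgeConjecture.CorCM.Cruxes.HypDel.F3DualAbelianSchemeMc.N3`, over a Noetherian `ℚ`-algebra)
re-run VERBATIM over ANY Noetherian affine base `Spec R`, the three `ℚ`-dependent inputs replaced by their any-characteristic ★ twins:
S-b ★ `existsUnique_detClassH_eq_add_truncExp_smallExtension_anyBase` (`AbelianSchemeSmallExtensionPicardTorsorAnyChar`), S-e ★
`exists_lift_detClassH_eq_add_smallExtension_anyBase` (`PoincareFamilyKSSurjectiveAnyChar`, over [MumfordAV1970] §13 Cor. 2 in any characteristic),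
S-f ★ `exists_graphPoint_residueField_of_sock_of_pointsInjective` (`GraphPointLevelZeroAnyChar`: [MumfordAV1970] §8 Thm. 1 in any characteristic + fpqc
descent), the latter's `hinjT` («points of `Â′` are detected by `𝒫′` on all test objects») being ★ `PoincareFamilyPointsInjective.eq_of_nonempty_pullback_poincare_iso`
— so the tower needs NO injectivity hypothesis and NO `CharZero κ(t)`.

* `graphPoints_injective` — (N2b′) graph points over a geometric point are unique (★ `eq_of_nonempty_pullback_baseChangeToProd_iso_of_socket`);
* (private) Artin-local bookkeeping `isArtinianRing∕isLocalRing_quotient_maximalIdeal_pow'`, `exists_socle_elem`;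
* **`graphPoint_step`** — (G2) ONE STEP along a principal small extension `C′ ↠ C`: S-a ★ `Deformation.exists_over_lift_of_smooth_smallExtension`, S-b, S-e,
  ★ `Modules.nonempty_iso_of_detClassH_eq_add`;
* **`graphPoint_tower`** — (G3) Noetherian induction on the kernel of `𝒪_{T′,t} ↠ C′` (base S-f, step (G2)).

Sequel: `MumfordDualUniversalityAnyChar` (N3′ head + (Mc) universality), `MumfordDualOfConnectedAffineAnyChar` ((M)), and the road-(A) head of
`DualPairOfAmpleRigidified`.  HC_CM is proved only modulo the printed citations (2 remaining named inputs hLiu418 24832, h413 24833) until rung 0 closes;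
nothing here is about HC (count-neutral ★ capital).

## References
* [MumfordAV1970] D. Mumford, *Abelian Varieties* (1970), §13 (Thm. p. 125 and its proof, pp. 125–130), §8 (p. 77).
* [Hartshorne2010] R. Hartshorne, *Deformation Theory* (2010), §6 (6.1) (p. 46), Thm. 6.4 (a)–(d), Rem. 6.4.1 (pp. 50–51).
* [Hartshorne1977] R. Hartshorne, *Algebraic Geometry* (1977), Ch. II Prop. 5.9 (p. 116); III Ex. 4.5.
* [GortzWedhorn2020] U. Görtz, T. Wedhorn, *Algebraic Geometry I*, 2nd ed. (2020), Section (4.7) (pp. 107–108).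
* [StacksProject] The Stacks Project, Tags 06GD, 06GE, 00J8.
-/

noncomputable section

open CategoryTheory CategoryTheory.Limits AlgebraicGeometry MonoidalCategory CartesianMonoidalCategory
open scoped MonObj
open Literature.AlgebraicGeometry Literature.AlgebraicGeometry.AbelianSchemes
open Literature.AlgebraicGeometry.Motives Literature.AlgebraicGeometry.AbelianVarieties Literature.AlgebraicGeometry.Modules
open Literature.AlgebraicGeometry.Deformation

namespace Literature.AlgebraicGeometry.AbelianSchemes

namespace MumfordDual

/-! ## (N2b′) uniqueness of graph points over geometric points -/

/-- **(N2b′) graph points over a geometric point are UNIQUE** — the (Mc) letter `stub_McN2b` with the signed `(hL : HasRank L 1)`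
reshape, by B-p16 (g18)'s body (its binder `[Algebra ℚ R]` was idle and is dropped): lift both `Ω`-points through the surjective `π`, read the socket on slices, conclude by the kernel clause
(★ `AbelianSchemeOver.eq_of_nonempty_pullback_baseChangeToProd_iso_of_socket`). [cite: MumfordAV1970, §13 Theorem (p. 125) and §8 (p. 77)] -/
theorem graphPoints_injective : ∀ (R : Type) [CommRing R] [IsNoetherianRing R] (A : AbelianSchemeOver (Spec (.of R)))
    (L : A.left.Modules) (hL : HasRank L 1)
    {S' : Scheme.{0}} [IsAffine S'] (p : S' ⟶ Spec (.of R)) [IsFinite p] [Etale p]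
    (hat : AbelianSchemeOver S') (π : (A.baseChange p).X ⟶ hat.X) [IsMonHom π]
    (_hπ : IsFinite π.left ∧ Etale π.left ∧ Surjective π.left)
    (P : ((A.baseChange p).prodLeft hat).Modules)
    (_hker : ∀ (T : Over S') (u : T ⟶ (A.baseChange p).X),
      u ≫ π = 1 ↔ (A.baseChange p).MemKOfL ((Scheme.Modules.pullback (pullback.fst A.X.hom p)).obj L) u)
    (_h1 : HasRank P 1)
    (_hsock : Nonempty ((Scheme.Modules.pullback ((A.baseChange p).X ◁ π).left).obj P ≅
      (A.baseChange p).mumfordBundle ((Scheme.Modules.pullback (pullback.fst A.X.hom p)).obj L)))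
    (T' : Over S') (ℒ : (A.baseChange p).RigidifiedLineBundle T'.hom) (_hℒ : ℒ.FibrewisePicZero)
    {Ω : Type} [Field Ω] [IsAlgClosed Ω] (s : Spec (.of Ω) ⟶ S') (u u' : Over.mk s ⟶ T' ⊗ hat.X),
    u ≫ CartesianMonoidalCategory.fst T' hat.X = u' ≫ CartesianMonoidalCategory.fst T' hat.X →
    Nonempty ((Scheme.Modules.pullback ((A.baseChange p).baseChangeToProd hat (Over.mk s).hom
        (u ≫ CartesianMonoidalCategory.snd T' hat.X).left (Over.w (u ≫ CartesianMonoidalCategory.snd T' hat.X)))).obj P ≅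
      (Scheme.Modules.pullback ((A.baseChange p).X ◁ (u ≫ CartesianMonoidalCategory.fst T' hat.X)).left).obj ℒ.L) →
    Nonempty ((Scheme.Modules.pullback ((A.baseChange p).baseChangeToProd hat (Over.mk s).hom
        (u' ≫ CartesianMonoidalCategory.snd T' hat.X).left (Over.w (u' ≫ CartesianMonoidalCategory.snd T' hat.X)))).obj P ≅
      (Scheme.Modules.pullback ((A.baseChange p).X ◁ (u' ≫ CartesianMonoidalCategory.fst T' hat.X)).left).obj ℒ.L) →
    u ≫ CartesianMonoidalCategory.snd T' hat.X = u' ≫ CartesianMonoidalCategory.snd T' hat.X := by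
  -- (N2b′) by name: B-p16 (g18)'s body over ★ `AbelianSchemes/MumfordQuotientSliceInjective` (p792862).
  intro R _ _ A L hL S' _ p _ _ hat π _ hπ P hker _h1 hsock T' ℒ _hℒ Ω _ _ s u u' hfst hu hu'
  haveI : IsFinite π.left := hπ.1
  haveI : Surjective π.left := hπ.2.2
  obtain ⟨eu⟩ := hu
  obtain ⟨eu'⟩ := hu'
  have e : Nonempty ((Scheme.Modules.pullback ((A.baseChange p).baseChangeToProd hat (Over.mk s).hom
        (u ≫ CartesianMonoidalCategory.snd T' hat.X).left (Over.w (u ≫ CartesianMonoidalCategory.snd T' hat.X)))).obj P ≅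
      (Scheme.Modules.pullback ((A.baseChange p).baseChangeToProd hat (Over.mk s).hom
        (u' ≫ CartesianMonoidalCategory.snd T' hat.X).left (Over.w (u' ≫ CartesianMonoidalCategory.snd T' hat.X)))).obj P) :=
    ⟨eu ≪≫ eqToIso (by rw [hfst]) ≪≫ eu'.symm⟩
  exact Over.OverMorphism.ext ((A.baseChange p).eq_of_nonempty_pullback_baseChangeToProd_iso_of_socket hat π P hsock
    (hasRank_pullback _ hL) (fun T v hv => (hker T v).2 hv) s _ _ (Over.w _) (Over.w _) e)

/-! ## The glue G2–G3 of the N3′ tower ((G0)∕(G1) are ★ `AbelianSchemeOver.whiskerLeft_comp_left` ∕ `nonempty_graphIso_precomp`) -/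

/-- `R/𝔪ⁿ⁺¹` is Artinian for a Noetherian local `(R, 𝔪)` (adapted from ★ `Morphisms/SteinOfArtinLevels`, private there).
[cite: StacksProject, Tag 00J8] -/
private theorem isArtinianRing_quotient_maximalIdeal_pow' {R₀ : Type} [CommRing R₀] [IsNoetherianRing R₀] [IsLocalRing R₀] (n : ℕ) :
    IsArtinianRing (R₀ ⧸ IsLocalRing.maximalIdeal R₀ ^ (n + 1)) := by
  apply IsLocalRing.quotient_artinian_of_mem_minimalPrimes_of_isLocalRing
  refine ⟨⟨inferInstance, Ideal.pow_le_self (Nat.succ_ne_zero n)⟩, ?_⟩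
  rintro q ⟨hq, hle⟩ -
  haveI := hq
  exact (Ideal.IsPrime.pow_le_iff (I := IsLocalRing.maximalIdeal R₀) (P := q) (Nat.succ_ne_zero n)).mp hle

/-- `R/𝔪ⁿ⁺¹` is local (adapted from ★ `Morphisms/SteinOfArtinLevels`, private there). [cite: StacksProject, Tag 00J8] -/
private theorem isLocalRing_quotient_maximalIdeal_pow' {R₀ : Type} [CommRing R₀] [IsLocalRing R₀] (n : ℕ) :
    IsLocalRing (R₀ ⧸ IsLocalRing.maximalIdeal R₀ ^ (n + 1)) := by
  have hne : IsLocalRing.maximalIdeal R₀ ^ (n + 1) ≠ ⊤ := fun h =>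
    (IsLocalRing.maximalIdeal.isMaximal R₀).ne_top
      (top_le_iff.mp (h ▸ Ideal.pow_le_self (Nat.succ_ne_zero n)))
  haveI : Nontrivial (R₀ ⧸ IsLocalRing.maximalIdeal R₀ ^ (n + 1)) := Ideal.Quotient.nontrivial_iff.mpr hne
  exact IsLocalRing.of_surjective' (Ideal.Quotient.mk _) Ideal.Quotient.mk_surjective

/-- **A socle element**: an Artinian local ring which is not a field has `t₀ ≠ 0` in `𝔪` with `t₀ · 𝔪 = 0` (take `t₀ ∈ 𝔪^{N-1} ∖ 0`
for the least `N` with `𝔪^N = 0`); `C ↠ C⁄(t₀)` is then a principal small extension. [cite: StacksProject, Tag 06GE (proof) and Tag 00J8] -/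
private theorem exists_socle_elem (C : Type) [CommRing C] [IsArtinianRing C] [IsLocalRing C]
    (h : IsLocalRing.maximalIdeal C ≠ ⊥) :
    ∃ t₀ : C, t₀ ≠ 0 ∧ t₀ ∈ IsLocalRing.maximalIdeal C ∧ ∀ m ∈ IsLocalRing.maximalIdeal C, t₀ * m = 0 := by
  classical
  have hex : ∃ k : ℕ, IsLocalRing.maximalIdeal C ^ k = ⊥ := by
    obtain ⟨k, hk⟩ := IsArtinianRing.isNilpotent_jacobson_bot (R := C)
    exact ⟨k, by rwa [IsLocalRing.jacobson_eq_maximalIdeal ⊥ bot_ne_top] at hk⟩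
  have hN : IsLocalRing.maximalIdeal C ^ Nat.find hex = ⊥ := Nat.find_spec hex
  have hN0 : Nat.find hex ≠ 0 := by
    intro h0
    have h' := hN
    rw [h0, pow_zero, Ideal.one_eq_top] at h'
    exact top_ne_bot h'
  have hN1 : Nat.find hex ≠ 1 := by
    intro h1
    have h' := hN
    rw [h1, pow_one] at h'
    exact h h'
  have hne : IsLocalRing.maximalIdeal C ^ (Nat.find hex - 1) ≠ ⊥ := Nat.find_min hex (by omega)
  obtain ⟨t₀, ht₀, ht₀0⟩ := Submodule.exists_mem_ne_zero_of_ne_bot hne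
  refine ⟨t₀, ht₀0, Ideal.pow_le_self (by omega) ht₀, fun m hm => ?_⟩
  have hmem : t₀ * m ∈ IsLocalRing.maximalIdeal C ^ (Nat.find hex - 1 + 1) := by
    rw [pow_succ]
    exact Ideal.mul_mem_mul ht₀ hm
  rwa [Nat.sub_add_cancel (by omega), hN, Ideal.mem_bot] at hmem

/-- (G2) **THE ONE-STEP LEMMA** — «graph point at level `C` ⇒ graph point at level `C′`» along a principal small extension `C′ ↠ C` of
Artinian local rings over `S′`, for a `C′`-valued point `x′` of `T′`: S-a lifts the `C`-level graph point `g` to some `g₁`; the two rank-one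
liftings `(1 × g₁)^*𝒫′` and `ℒ_{C′} := (1 × x′)^*ℒ` of `E := ℒ_C` differ by a unique defect `t ∈ H¹(𝓘)` (S-b); S-e moves the lift to
`g₂` with class `[(1 × g₁)^*𝒫′] + t = [ℒ_{C′}]`, and equal classes of liftings give an isomorphism (★ `Modules.nonempty_iso_of_detClassH_eq_add`).
[cite: MumfordAV1970, §13 (proof of the Thm., pp. 125–130)] [cite: Hartshorne2010, §6 Thm. 6.4 (b)–(d) (pp. 50–51)] -/
theorem graphPoint_step (R : Type) [CommRing R] [IsNoetherianRing R] (A : AbelianSchemeOver (Spec (.of R)))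
    (L : A.left.Modules) (hL : HasRank L 1)
    (hε : CechPic.pullback A.unitSection (detClass (HasRank.isFiniteLocallyFree' hL)) = 1)
    (hΘ : ∀ ⦃Ω : Type⦄ [Field Ω] [IsAlgClosed Ω] (s : Spec (.of Ω) ⟶ Spec (.of R)),
      ∃ Θ : CartierDivisor (A.fibre s).toAbelianVariety.X.left, Θ.IsAmple ∧
        CechPic.pullback (X := (A.fibre s).toAbelianVariety.X.left) (pullback.fst A.X.hom s)
          (detClass (HasRank.isFiniteLocallyFree' hL)) = Θ.cechClass)
    {S' : Scheme.{0}} [IsAffine S'] (p : S' ⟶ Spec (.of R)) [IsFinite p] [Etale p] [Surjective p]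
    (hH1 : ∀ (K₁ : Type) [Field K₁] (s : Spec (.of K₁) ⟶ S') {J : Type} [Finite J]
      (U : J → ((A.baseChange p).X ⊗ Over.mk s).left.Opens), (∀ i, IsAffineOpen (U i)) → iSup U = ⊤ →
      Module.Finite K₁ (Literature.AlgebraicGeometry.Morphisms.CechH1 (X := ((A.baseChange p).X ⊗ Over.mk s).left) (Limits.pullback.snd (A.baseChange p).X.hom s) U) ∧
        Module.finrank K₁ (Literature.AlgebraicGeometry.Morphisms.CechH1 (X := ((A.baseChange p).X ⊗ Over.mk s).left) (Limits.pullback.snd (A.baseChange p).X.hom s) U) =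
          ((A.baseChange p).fibre s).toAbelianVariety.dim)
    (hat : AbelianSchemeOver S') (π : (A.baseChange p).X ⟶ hat.X) [IsMonHom π]
    (hπ : IsFinite π.left ∧ Etale π.left ∧ Surjective π.left)
    (P : ((A.baseChange p).prodLeft hat).Modules)
    (hker : ∀ (T : Over S') (u : T ⟶ (A.baseChange p).X),
      u ≫ π = 1 ↔ (A.baseChange p).MemKOfL ((Scheme.Modules.pullback (pullback.fst A.X.hom p)).obj L) u)
    (h1 : HasRank P 1)
    (hrig : Nonempty ((Scheme.Modules.pullback ((A.baseChange p).unitSlice hat)).obj P ≅ SheafOfModules.unit _))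
    (hsock : Nonempty ((Scheme.Modules.pullback ((A.baseChange p).X ◁ π).left).obj P ≅
      (A.baseChange p).mumfordBundle ((Scheme.Modules.pullback (pullback.fst A.X.hom p)).obj L)))
    (C' C : Type) [CommRing C'] [IsLocalRing C'] [IsArtinianRing C'] [CommRing C] [IsLocalRing C] [IsArtinianRing C]
    (q : C' →+* C) (hq : Function.Surjective q) (t₀ : C') (hker₀ : RingHom.ker q = Ideal.span {t₀})
    (htm : ∀ m ∈ IsLocalRing.maximalIdeal C', t₀ * m = 0) (ht₀m : t₀ ∈ IsLocalRing.maximalIdeal C')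
    (c' : Spec (.of C') ⟶ S')
    (ι₀ : Over.mk (Spec.map (CommRingCat.ofHom q) ≫ c') ⟶ Over.mk c') (hι : ι₀.left = Spec.map (CommRingCat.ofHom q))
    [IsFirstOrderThickening ((A.baseChange p).X ◁ ι₀).left]
    {T' : Over S'} (ℒ : (A.baseChange p).RigidifiedLineBundle T'.hom)
    (x' : Over.mk c' ⟶ T') (g : Over.mk (Spec.map (CommRingCat.ofHom q) ≫ c') ⟶ hat.X)
    (hg : Nonempty ((Scheme.Modules.pullback ((A.baseChange p).baseChangeToProd hat (Spec.map (CommRingCat.ofHom q) ≫ c')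
        g.left (Over.w g))).obj P ≅
      (Scheme.Modules.pullback ((A.baseChange p).X ◁ (ι₀ ≫ x')).left).obj ℒ.L)) :
    ∃ g' : Over.mk c' ⟶ hat.X, ι₀ ≫ g' = g ∧
      Nonempty ((Scheme.Modules.pullback ((A.baseChange p).baseChangeToProd hat c' g'.left (Over.w g'))).obj P ≅
        (Scheme.Modules.pullback ((A.baseChange p).X ◁ x').left).obj ℒ.L) := by
  -- S-a: a lift `g₁` of `g`
  obtain ⟨g₁, hg₁⟩ := Literature.AlgebraicGeometry.Deformation.exists_over_lift_of_smooth_smallExtension hat.X hat.isSmooth C' C q hq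
    t₀ hker₀ (htm t₀ ht₀m) c' ι₀ hι g
  -- the rank-one modules: `M′ = ℒ_{C′}`, `E = ℒ_C = i^*M′`, `L₁ = (1 × g₁)^*𝒫′`
  have hM' : HasRank ((Scheme.Modules.pullback ((A.baseChange p).X ◁ x').left).obj ℒ.L) 1 :=
    hasRank_pullback _ ℒ.hasRank_one
  have hE : HasRank ((Scheme.Modules.pullback ((A.baseChange p).X ◁ ι₀).left).obj
      ((Scheme.Modules.pullback ((A.baseChange p).X ◁ x').left).obj ℒ.L)) 1 :=
    hasRank_pullback _ hM'
  have hL₁ : HasRank ((Scheme.Modules.pullback ((A.baseChange p).baseChangeToProd hat c' g₁.left (Over.w g₁))).obj P) 1 :=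
    hasRank_pullback _ h1
  -- `L₁` lifts `E`
  have e₁ : Nonempty ((Scheme.Modules.pullback ((A.baseChange p).X ◁ ι₀).left).obj
      ((Scheme.Modules.pullback ((A.baseChange p).baseChangeToProd hat c' g₁.left (Over.w g₁))).obj P) ≅
      (Scheme.Modules.pullback ((A.baseChange p).X ◁ ι₀).left).obj
        ((Scheme.Modules.pullback ((A.baseChange p).X ◁ x').left).obj ℒ.L)) := by
    obtain ⟨e⟩ := hg
    have hb₁ : (A.baseChange p).baseChangeToProd hat c' g₁.left (Over.w g₁) = ((A.baseChange p).X ◁ g₁).left :=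
      (A.baseChange p).baseChangeToProd_eq_whiskerLeft_left hat g₁
    have hb : (A.baseChange p).baseChangeToProd hat (Spec.map (CommRingCat.ofHom q) ≫ c') g.left (Over.w g) =
        ((A.baseChange p).X ◁ ι₀).left ≫ ((A.baseChange p).X ◁ g₁).left := by
      rw [← (A.baseChange p).whiskerLeft_comp_left ι₀ g₁, hg₁]
      exact (A.baseChange p).baseChangeToProd_eq_whiskerLeft_left hat g
    have hx : ((A.baseChange p).X ◁ ι₀).left ≫ ((A.baseChange p).X ◁ x').left = ((A.baseChange p).X ◁ (ι₀ ≫ x')).left :=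
      ((A.baseChange p).whiskerLeft_comp_left ι₀ x').symm
    exact ⟨(Scheme.Modules.pullback ((A.baseChange p).X ◁ ι₀).left).mapIso ((Scheme.Modules.pullbackCongr hb₁).app P) ≪≫
      (Scheme.Modules.pullbackComp ((A.baseChange p).X ◁ ι₀).left ((A.baseChange p).X ◁ g₁).left).app P ≪≫
      (Scheme.Modules.pullbackCongr hb.symm).app P ≪≫ e ≪≫
      (Scheme.Modules.pullbackCongr hx.symm).app ℒ.L ≪≫
      ((Scheme.Modules.pullbackComp ((A.baseChange p).X ◁ ι₀).left ((A.baseChange p).X ◁ x').left).app ℒ.L).symm⟩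
  -- S-b: the defect `t` of `M′` against `L₁`
  obtain ⟨t, ht, -⟩ := AbelianSchemeOver.existsUnique_detClassH_eq_add_truncExp_smallExtension_anyBase R A p C' C q hq t₀ hker₀ htm ht₀m
    c' ι₀ hι _ hE ⟨_, hL₁, e₁⟩ _ _ hL₁ hM' e₁ ⟨Iso.refl _⟩
  -- S-e: move the lift to realise `t`
  obtain ⟨g₂, hg₂, hc₂⟩ :=
    AbelianSchemeOver.exists_lift_detClassH_eq_add_smallExtension_anyBase R A L hL hε hΘ p hH1 hat π hπ P hker h1 hrig hsock C' C q
      hq t₀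
      hker₀ htm ht₀m c' ι₀ hι g₁ t
  refine ⟨g₂, hg₂.trans hg₁, ?_⟩
  exact Modules.nonempty_iso_of_detClassH_eq_add ((A.baseChange p).X ◁ ι₀).left hL₁ (hasRank_pullback _ h1) hM' t hc₂ ht

/-- (G3) **THE TOWER** — Noetherian induction on the kernel `K` of a surjection `ψ : 𝒪_{T′,t} ↠ C′` onto an Artinian local ring: every
`C′`-valued point `x` of `T′` «through `t`» (`x = Spec ψ ≫ (Spec 𝒪_{T′,t} → T′)`) carries a graph point.  Base (`C′` a field): `x` factors
through `Spec κ(t)` and the level-0 graph point (S-f) pulls back (G1).  Step: a socle element `t₀` of `C′` gives the principal small extension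
`C′ ↠ C′⁄(t₀)` (kernel of `𝒪_{T′,t} ↠ C′⁄(t₀)` strictly larger), the induction hypothesis gives a graph point at level `C′⁄(t₀)`, and the
one-step lemma (G2) lifts it (the first-order-thickening instance by ★ `Modules.isFirstOrderThickening_of_smallExtension` through ★
`isPullback_whiskerLeft_left`). [cite: MumfordAV1970, §13 (proof of the Thm., pp. 125–130)] [cite: Hartshorne2010, §6 (6.1) (p. 46) and Thm. 6.4 (pp. 50–51)] -/
theorem graphPoint_tower (R : Type) [CommRing R] [IsNoetherianRing R] (A : AbelianSchemeOver (Spec (.of R)))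
    (L : A.left.Modules) (hL : HasRank L 1)
    (hε : CechPic.pullback A.unitSection (detClass (HasRank.isFiniteLocallyFree' hL)) = 1)
    (hΘ : ∀ ⦃Ω : Type⦄ [Field Ω] [IsAlgClosed Ω] (s : Spec (.of Ω) ⟶ Spec (.of R)),
      ∃ Θ : CartierDivisor (A.fibre s).toAbelianVariety.X.left, Θ.IsAmple ∧
        CechPic.pullback (X := (A.fibre s).toAbelianVariety.X.left) (pullback.fst A.X.hom s)
          (detClass (HasRank.isFiniteLocallyFree' hL)) = Θ.cechClass)
    {S' : Scheme.{0}} [IsAffine S'] (p : S' ⟶ Spec (.of R)) [IsFinite p] [Etale p] [Surjective p]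
    (hH1 : ∀ (K₁ : Type) [Field K₁] (s : Spec (.of K₁) ⟶ S') {J : Type} [Finite J]
      (U : J → ((A.baseChange p).X ⊗ Over.mk s).left.Opens), (∀ i, IsAffineOpen (U i)) → iSup U = ⊤ →
      Module.Finite K₁ (Literature.AlgebraicGeometry.Morphisms.CechH1 (X := ((A.baseChange p).X ⊗ Over.mk s).left) (Limits.pullback.snd (A.baseChange p).X.hom s) U) ∧
        Module.finrank K₁ (Literature.AlgebraicGeometry.Morphisms.CechH1 (X := ((A.baseChange p).X ⊗ Over.mk s).left) (Limits.pullback.snd (A.baseChange p).X.hom s) U) =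
          ((A.baseChange p).fibre s).toAbelianVariety.dim)
    (hat : AbelianSchemeOver S') (π : (A.baseChange p).X ⟶ hat.X) [IsMonHom π]
    (hπ : IsFinite π.left ∧ Etale π.left ∧ Surjective π.left)
    (P : ((A.baseChange p).prodLeft hat).Modules)
    (hker : ∀ (T : Over S') (u : T ⟶ (A.baseChange p).X),
      u ≫ π = 1 ↔ (A.baseChange p).MemKOfL ((Scheme.Modules.pullback (pullback.fst A.X.hom p)).obj L) u)
    (h1 : HasRank P 1)
    (hrig : Nonempty ((Scheme.Modules.pullback ((A.baseChange p).unitSlice hat)).obj P ≅ SheafOfModules.unit _))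
    (hsock : Nonempty ((Scheme.Modules.pullback ((A.baseChange p).X ◁ π).left).obj P ≅
      (A.baseChange p).mumfordBundle ((Scheme.Modules.pullback (pullback.fst A.X.hom p)).obj L)))
    (T' : Over S') (ℒ : (A.baseChange p).RigidifiedLineBundle T'.hom) (hℒ : ℒ.FibrewisePicZero)
    (t : T'.left) [IsNoetherianRing (T'.left.presheaf.stalk t)] :
    ∀ (K : Ideal (T'.left.presheaf.stalk t)) (C' : Type) [CommRing C'] [IsLocalRing C'] [IsArtinianRing C']
      (ψ : (T'.left.presheaf.stalk t : Type) →+* C') (_ : Function.Surjective ψ) (_ : RingHom.ker ψ = K)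
      (s : Spec (.of C') ⟶ S') (x : Over.mk s ⟶ T') (_ : x.left = Spec.map (CommRingCat.ofHom ψ) ≫ T'.left.fromSpecStalk t),
      ∃ y : Over.mk s ⟶ hat.X,
        Nonempty ((Scheme.Modules.pullback ((A.baseChange p).baseChangeToProd hat s y.left (Over.w y))).obj P ≅
          (Scheme.Modules.pullback ((A.baseChange p).X ◁ x).left).obj ℒ.L) := by
  -- points of `Â′` are detected by `𝒫′` on ALL test objects (★ `eq_of_nonempty_pullback_poincare_iso`, any characteristic)
  haveI : IsLocallyNoetherian S' := LocallyOfFiniteType.isLocallyNoetherian p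
  haveI : Etale π.left := hπ.2.1
  haveI : Flat π.left := inferInstance
  haveI : Surjective π.left := hπ.2.2
  have hinjT : ∀ ⦃T : Over S'⦄ (y y' : T ⟶ hat.X),
      Nonempty ((Scheme.Modules.pullback ((A.baseChange p).baseChangeToProd hat T.hom y.left (Over.w y))).obj P ≅
        (Scheme.Modules.pullback ((A.baseChange p).baseChangeToProd hat T.hom y'.left (Over.w y'))).obj P) → y = y' :=
    fun T y y' h => (A.baseChange p).eq_of_nonempty_pullback_poincare_iso hat π (hasRank_pullback _ hL)
      (A.cechPic_pullback_unitSection_baseChange_eq_one p hL hε) hker P hsock y y' h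
  intro K
  induction K using IsNoetherian.induction with
  | hgt K IH =>
  intro C' _ _ _ ψ hψ hK s x hx
  classical
  by_cases hbot : IsLocalRing.maximalIdeal C' = ⊥
  · /- BASE: `C′` is a field, so `ψ` kills `𝔪_t` and `x` factors through `Spec κ(t)`; pull the level-0 graph point (S-f) back (G1). -/
    haveI := IsLocalHom.of_surjective ψ hψ
    have H : ∀ a ∈ IsLocalRing.maximalIdeal (T'.left.presheaf.stalk t : Type), ψ a = 0 := fun a ha => by
      have h := map_nonunit ψ a ha
      rwa [hbot, Ideal.mem_bot] at h
    let r : (T'.left.residueField t : Type) →+* C' := Ideal.Quotient.lift _ ψ H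
    have hcomp : T'.left.residue t ≫ CommRingCat.ofHom r = CommRingCat.ofHom ψ :=
      CommRingCat.hom_ext (RingHom.ext fun a =>
        Ideal.Quotient.lift_mk (IsLocalRing.maximalIdeal (T'.left.presheaf.stalk t : Type)) ψ H)
    have h2 : Spec.map (CommRingCat.ofHom r) ≫ Spec.map (T'.left.residue t) = Spec.map (CommRingCat.ofHom ψ) := by
      rw [← Spec.map_comp]
      exact congrArg Spec.map hcomp
    have key : Spec.map (CommRingCat.ofHom r) ≫ T'.left.fromSpecResidueField t = x.left := by
      rw [hx, Scheme.fromSpecResidueField, ← Category.assoc, h2]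
    obtain ⟨y₀, hy₀⟩ := (A.baseChange p).exists_graphPoint_residueField_of_sock_of_pointsInjective (hasRank_pullback _ hL)
      (A.exists_isAmple_cechClass_fibre_baseChange hL hΘ p (hasRank_pullback _ hL)) hat π P h1 hsock ℒ hℒ hinjT t
    let b : Over.mk s ⟶ Over.mk (T'.left.fromSpecResidueField t ≫ T'.hom) :=
      Over.homMk (Spec.map (CommRingCat.ofHom r)) (by
        change Spec.map (CommRingCat.ofHom r) ≫ T'.left.fromSpecResidueField t ≫ T'.hom = s
        rw [← Category.assoc, key]
        exact Over.w x)
    have hb : b ≫ Over.homMk (T'.left.fromSpecResidueField t) rfl = x := by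
      ext
      rw [Over.comp_left]
      exact key
    have h := (A.baseChange p).nonempty_graphIso_precomp hat P ℒ b (Over.homMk (T'.left.fromSpecResidueField t) rfl) y₀ hy₀
    rw [hb] at h
    exact ⟨b ≫ y₀, h⟩
  · /- STEP: a socle element `t₀` of `C′`, the principal small extension `q : C′ ↠ C′⁄(t₀)`, the induction hypothesis at the
    strictly larger kernel, and the one-step lemma (G2). -/
    obtain ⟨t₀, ht0, ht₀m, htm⟩ := exists_socle_elem C' hbot
    have hne : Ideal.span {t₀} ≠ ⊤ := by
      rw [Ne, Ideal.span_singleton_eq_top]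
      exact (IsLocalRing.mem_maximalIdeal _).mp ht₀m
    haveI : Nontrivial (C' ⧸ Ideal.span {t₀}) := Ideal.Quotient.nontrivial_iff.mpr hne
    haveI : IsLocalRing (C' ⧸ Ideal.span {t₀}) :=
      IsLocalRing.of_surjective' (Ideal.Quotient.mk _) Ideal.Quotient.mk_surjective
    have hq : Function.Surjective (Ideal.Quotient.mk (Ideal.span {t₀})) := Ideal.Quotient.mk_surjective
    have hker₀ : RingHom.ker (Ideal.Quotient.mk (Ideal.span {t₀})) = Ideal.span {t₀} := Ideal.mk_ker
    have hK' : K < RingHom.ker ((Ideal.Quotient.mk (Ideal.span {t₀})).comp ψ) := by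
      rw [← hK]
      refine lt_of_le_of_ne (fun a ha => ?_) (fun heq => ht0 ?_)
      · rw [RingHom.mem_ker] at ha ⊢
        rw [RingHom.comp_apply, ha, map_zero]
      · obtain ⟨a, ha⟩ := hψ t₀
        have ha' : a ∈ RingHom.ker ((Ideal.Quotient.mk (Ideal.span {t₀})).comp ψ) := by
          rw [RingHom.mem_ker, RingHom.comp_apply, ha, Ideal.Quotient.eq_zero_iff_mem]
          exact Ideal.mem_span_singleton_self _
        rw [← heq, RingHom.mem_ker, ha] at ha'
        exact ha'
    let ι₀ : Over.mk (Spec.map (CommRingCat.ofHom (Ideal.Quotient.mk (Ideal.span {t₀}))) ≫ s) ⟶ Over.mk s :=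
      Over.homMk (Spec.map (CommRingCat.ofHom (Ideal.Quotient.mk (Ideal.span {t₀})))) rfl
    have hι : ι₀.left = Spec.map (CommRingCat.ofHom (Ideal.Quotient.mk (Ideal.span {t₀}))) := rfl
    obtain ⟨y₁, hy₁⟩ := IH _ hK' (C' ⧸ Ideal.span {t₀}) ((Ideal.Quotient.mk (Ideal.span {t₀})).comp ψ)
      (hq.comp hψ) rfl (Spec.map (CommRingCat.ofHom (Ideal.Quotient.mk (Ideal.span {t₀}))) ≫ s) (ι₀ ≫ x)
      (by rw [Over.comp_left, hι, hx, CommRingCat.ofHom_comp, Spec.map_comp, Category.assoc]; rfl)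
    haveI : IsFirstOrderThickening ((A.baseChange p).X ◁ ι₀).left :=
      Modules.isFirstOrderThickening_of_smallExtension (pullback.snd (A.baseChange p).X.hom s)
        (Ideal.Quotient.mk (Ideal.span {t₀})) hq t₀ hker₀
        (pullback.snd (A.baseChange p).X.hom (Spec.map (CommRingCat.ofHom (Ideal.Quotient.mk (Ideal.span {t₀}))) ≫ s))
        htm ht₀m (RelativeSpec.ActionOver.IsGeometricQuotient.isPullback_whiskerLeft_left ι₀ (A.baseChange p).X).flip
    obtain ⟨g', -, hg'⟩ := graphPoint_step R A L hL hε hΘ p hH1 hat π hπ P hker h1 hrig hsock C' (C' ⧸ Ideal.span {t₀})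
      (Ideal.Quotient.mk (Ideal.span {t₀})) hq t₀ hker₀ htm ht₀m s ι₀ hι ℒ x y₁ hy₁
    exact ⟨g', hg'⟩

end MumfordDual

end Literature.AlgebraicGeometry.AbelianSchemes

end
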